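import Summits.MatrixMultiplication.MatrixMultiplication.Theorems.SoloInformedValInducedMatching

/-!
# SoloInformedValVertexDegree — vertex links of normal-form triples, the biclique bound, and the failure of the local degree-product bound

Sequel of `SoloInformedValInducedMatching` (normal-form triples `x : I → G`, `y : J → G`, `z : K → G` on the
graphs `H_IJ, H_JK, H_KI` WITHOUT ACCIDENTAL SOLUTIONS, `NoAccidental`; their triangles are exactly the
solutions of `a + b + c = 0` in the associated trapezoid-free triple).  Write `n = |G|`, `T` for the number of
triangles and `t_v` for the number of triangles through a vertex `v` (the size of its LINK).

THE PACKING QUESTION (dossier `paper/val-superlinear.md` §15, (U2𝒩)): is `T³ ≤ n² · |I| · |J| · |K|` for every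
such configuration in a finite abelian group ("nothing packs better than perfect blocks")?  By Hölder's
inequality it would follow from the LOCAL DEGREE-PRODUCT BOUND
(U5) `t_i · t_j · t_k ≤ n²` for every triangle `(i, j, k)`,
which is an equality at every triangle of a perfect block `X × Y × Z`, `|X| |Y| |Z| = n`.  This file records:

* `NoAccidental.mono` — sub-graphs inherit the absence of accidental solutions;
* `NoAccidental.injOn_link`, `NoAccidental.card_link_le` — the link of an `I`-vertex `i` (the pairs `(j,k)`
  with `(i,j,k)` a triangle) is mapped injectively into `G` by `(j,k) ↦ y j - z k`; hence `t_i ≤ n`;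
* `NoAccidental.card_triangles_biclique_le` — THE BICLIQUE BOUND: if `J₀ × K₀ ⊆ H_JK` is a complete bipartite
  piece, the triangles whose `JK`-edge lies in `J₀ × K₀` number at most `n` (the sum of the codegrees over a
  biclique is at most `n`; with `J₀ × K₀ = Y × Z` this is "a complete block has volume at most `n`");
* `localDegreeProduct_counterexample` — (U5) IS FALSE: an explicit configuration in `G = (ℤ/2)⁴` (`n = 16`)
  without accidental solutions — one `I`-vertex, `|J| = 4`, `|K| = 6`, twelve triangles — with a triangle
  `(i₀, j₀, k₀)` having `t_{i₀} · t_{j₀} · t_{k₀} = 12 · 6 · 4 = 288 > 256 = n²` (kernel-checked by `decide`).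
  The dossier (§15.8) embeds it in a family in `(ℤ/2)^m` with `t_i t_j t_k / n² = 3n/64 → ∞`; the AVERAGED
  bound `∑_τ t_i t_j t_k ≤ n² T` (U6), which also implies (U2𝒩), is open.

solo-informed MatrixMultiplication, gen 77.  Elementary; no `sorry`.
-/

namespace Summit.MatrixMultiplication.MatrixMultiplication.Theorems.SoloVal

open Finset

section Links

variable {G : Type*} [AddCommGroup G]
variable {I J K : Type*}
variable {x : I → G} {y : J → G} {z : K → G}
variable {HIJ : Finset (I × J)} {HJK : Finset (J × K)} {HKI : Finset (K × I)}

/-- Sub-graphs inherit the absence of accidental solutions. -/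
theorem NoAccidental.mono (hN : NoAccidental x y z HIJ HJK HKI) {HIJ' : Finset (I × J)}
    {HJK' : Finset (J × K)} {HKI' : Finset (K × I)} (h1 : HIJ' ⊆ HIJ) (h2 : HJK' ⊆ HJK)
    (h3 : HKI' ⊆ HKI) : NoAccidental x y z HIJ' HJK' HKI' :=
  fun i j j' k k' i' hij hjk hki hsum => hN i j j' k k' i' (h1 hij) (h2 hjk) (h3 hki) hsum

/-- LINK INJECTIVITY.  Two triangles `(i, j, k)`, `(i, j', k')` through the same `I`-vertex with
`y j - z k = y j' - z k'` coincide: otherwise `(x i - y j) + (y j' - z k') + (z k - x i) = 0` would be an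
accidental solution. -/
theorem NoAccidental.injOn_link (hN : NoAccidental x y z HIJ HJK HKI) (i : I) :
    Set.InjOn (fun e : J × K => y e.1 - z e.2) {e | IsTriangle HIJ HJK HKI (i, e.1, e.2)} := by
  rintro ⟨j, k⟩ hjk ⟨j', k'⟩ hjk' heq
  simp only [Set.mem_setOf_eq, IsTriangle] at hjk hjk' heq
  obtain ⟨h1, -, h3⟩ := hjk
  obtain ⟨-, h2', -⟩ := hjk'
  have hsum : (x i - y j) + (y j' - z k') + (z k - x i) = 0 := by
    calc (x i - y j) + (y j' - z k') + (z k - x i) = (y j' - z k') - (y j - z k) := by abel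
      _ = 0 := sub_eq_zero.mpr heq.symm
  obtain ⟨-, hj, hk⟩ := hN i j j' k' k i h1 h2' h3 hsum
  rw [hj, hk]

/-- `t_i ≤ n`: a finite set of triangles through one `I`-vertex has at most `|G|` elements. -/
theorem NoAccidental.card_link_le [Fintype G] [DecidableEq G] (hN : NoAccidental x y z HIJ HJK HKI)
    (i : I) {S : Finset (I × J × K)} (hS : ∀ τ ∈ S, IsTriangle HIJ HJK HKI τ ∧ τ.1 = i) :
    S.card ≤ Fintype.card G := by
  have hinj : Set.InjOn (fun τ : I × J × K => y τ.2.1 - z τ.2.2) ↑S := by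
    rintro ⟨i₁, j, k⟩ hτ ⟨i₂, j', k'⟩ hτ' heq
    obtain ⟨ht, hi⟩ := hS _ (Finset.mem_coe.mp hτ)
    obtain ⟨ht', hi'⟩ := hS _ (Finset.mem_coe.mp hτ')
    simp only at hi hi' heq
    rw [hi] at ht
    rw [hi'] at ht'
    have h := hN.injOn_link i
      (show ((j, k) : J × K) ∈ {e : J × K | IsTriangle HIJ HJK HKI (i, e.1, e.2)} from ht)
      (show ((j', k') : J × K) ∈ {e : J × K | IsTriangle HIJ HJK HKI (i, e.1, e.2)} from ht') heq
    simp only [Prod.mk.injEq] at h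
    rw [hi, hi', h.1, h.2]
  calc S.card = (S.image (fun τ : I × J × K => y τ.2.1 - z τ.2.2)).card :=
      (Finset.card_image_of_injOn hinj).symm
    _ ≤ Fintype.card G := Finset.card_le_univ _

/-- THE BICLIQUE BOUND.  If `J₀ × K₀ ⊆ H_JK` (a complete bipartite piece of `H_JK`), then a finite set of
triangles whose `JK`-edges lie in `J₀ × K₀` has at most `|G|` elements: the sub-configuration
`(H_IJ, J₀ × K₀, H_KI)` has no accidental solutions and a cross-closed middle graph, hence is linear. -/
theorem NoAccidental.card_triangles_biclique_le [Fintype G] [DecidableEq G] [DecidableEq J]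
    [DecidableEq K] (hN : NoAccidental x y z HIJ HJK HKI) {J₀ : Finset J} {K₀ : Finset K}
    (hB : J₀ ×ˢ K₀ ⊆ HJK) {S : Finset (I × J × K)}
    (hS : ∀ τ ∈ S, IsTriangle HIJ HJK HKI τ ∧ τ.2.1 ∈ J₀ ∧ τ.2.2 ∈ K₀) :
    S.card ≤ Fintype.card G := by
  have hN' : NoAccidental x y z HIJ (J₀ ×ˢ K₀) HKI :=
    hN.mono (Finset.Subset.refl _) hB (Finset.Subset.refl _)
  have hS' : ∀ τ ∈ S, IsTriangle HIJ (J₀ ×ˢ K₀) HKI τ := by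
    intro τ hτ
    obtain ⟨⟨h1, -, h3⟩, hj, hk⟩ := hS τ hτ
    exact ⟨h1, Finset.mem_product.mpr ⟨hj, hk⟩, h3⟩
  have hcc : ∀ e ∈ J₀ ×ˢ K₀, ∀ e' ∈ J₀ ×ˢ K₀, (e.1, e'.2) ∈ J₀ ×ˢ K₀ := by
    intro e he e' he'
    rw [Finset.mem_product] at he he' ⊢
    exact ⟨he.1, he'.2⟩
  exact hN'.card_triangles_le_card_of_crossClosed hS' hcc

/-- In particular a complete block `X × (J₀ × K₀)`-worth of triangles — all `(i, j, k)` with `i ∈ I₀`, `j ∈ J₀`,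
`k ∈ K₀` triangles — has `|I₀| · |J₀| · |K₀| ≤ |G|` ("the volume of a complete block is at most `n`"). -/
theorem NoAccidental.card_completeBlock_le [Fintype G] [DecidableEq G] [DecidableEq I] [DecidableEq J]
    [DecidableEq K] (hN : NoAccidental x y z HIJ HJK HKI) {I₀ : Finset I} {J₀ : Finset J} {K₀ : Finset K}
    (hT : ∀ i ∈ I₀, ∀ j ∈ J₀, ∀ k ∈ K₀, IsTriangle HIJ HJK HKI (i, j, k)) :
    I₀.card * J₀.card * K₀.card ≤ Fintype.card G := by
  by_cases hI : I₀ = ∅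
  · simp [hI]
  obtain ⟨i₀, hi₀⟩ := Finset.nonempty_iff_ne_empty.mpr hI
  have hB : J₀ ×ˢ K₀ ⊆ HJK := by
    intro e he
    rw [Finset.mem_product] at he
    exact (hT i₀ hi₀ e.1 he.1 e.2 he.2).2.1
  have h := hN.card_triangles_biclique_le hB (S := I₀ ×ˢ (J₀ ×ˢ K₀)) (by
    intro τ hτ
    rw [Finset.mem_product, Finset.mem_product] at hτ
    exact ⟨hT _ hτ.1 _ hτ.2.1 _ hτ.2.2, hτ.2.1, hτ.2.2⟩)
  simpa [Finset.card_product, Nat.mul_assoc] using h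

end Links

/-! ### The failure of the local degree-product bound (U5)

The star configuration in `G = (ℤ/2)⁴`: one `I`-vertex `i₀` with potential `0`; `J`-potentials
`0000, 0001, 0010, 1010`; `K`-potentials `0000, 1001, 0100, 0111, 1100, 1111`; `H_IJ`, `H_KI` complete; `H_JK` =
the twelve pairs `(j, k)` whose difference `y j - z k` is uniquely represented in `Y - Z`.  It has no accidental
solutions, its twelve triangles all pass through `i₀`, six of them through `j₀ = 0` and four through `k₀ = 0`,
and `(i₀, j₀, k₀)` is a triangle: `t_{i₀} t_{j₀} t_{k₀} = 288 > 256 = |G|²`. -/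

section Counterexample

/-- The group `(ℤ/2)⁴` of the counterexample. -/
abbrev G16 : Type := ZMod 2 × ZMod 2 × ZMod 2 × ZMod 2

/-- `I`-potential: the single vertex sits at `0`. -/
def cxX : Fin 1 → G16 := fun _ => (0, 0, 0, 0)

/-- `J`-potentials `0000, 0001, 0010, 1010`. -/
def cxY : Fin 4 → G16 := ![(0, 0, 0, 0), (0, 0, 0, 1), (0, 0, 1, 0), (1, 0, 1, 0)]

/-- `K`-potentials `0000, 1001, 0100, 0111, 1100, 1111`. -/
def cxZ : Fin 6 → G16 :=
  ![(0, 0, 0, 0), (1, 0, 0, 1), (0, 1, 0, 0), (0, 1, 1, 1), (1, 1, 0, 0), (1, 1, 1, 1)]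

/-- `H_IJ`: complete. -/
def cxHIJ : Finset (Fin 1 × Fin 4) := Finset.univ

/-- `H_JK`: the twelve uniquely-represented pairs. -/
def cxHJK : Finset (Fin 4 × Fin 6) :=
  {(0, 0), (0, 1), (0, 2), (0, 3), (0, 4), (0, 5), (1, 0), (1, 1), (2, 0), (2, 1), (3, 0), (3, 1)}

/-- `H_KI`: complete. -/
def cxHKI : Finset (Fin 6 × Fin 1) := Finset.univ

/-- The configuration has no accidental solutions. -/
theorem cx_noAccidental : NoAccidental cxX cxY cxZ cxHIJ cxHJK cxHKI := by
  unfold NoAccidental cxX cxY cxZ cxHIJ cxHJK cxHKI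
  decide

/-- It has twelve triangles (all through the `I`-vertex `0`). -/
theorem cx_card_triangles : (triangleSet cxHIJ cxHJK cxHKI).card = 12 := by
  unfold triangleSet cxHIJ cxHJK cxHKI
  decide

/-- Six of them pass through the `J`-vertex `0`. -/
theorem cx_card_link_j0 : ((triangleSet cxHIJ cxHJK cxHKI).filter (fun τ => τ.2.1 = 0)).card = 6 := by
  unfold triangleSet cxHIJ cxHJK cxHKI
  decide

/-- Four of them pass through the `K`-vertex `0`. -/
theorem cx_card_link_k0 : ((triangleSet cxHIJ cxHJK cxHKI).filter (fun τ => τ.2.2 = 0)).card = 4 := by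
  unfold triangleSet cxHIJ cxHJK cxHKI
  decide

/-- `(0, 0, 0)` is a triangle. -/
theorem cx_triangle_000 : IsTriangle cxHIJ cxHJK cxHKI ((0 : Fin 1), (0 : Fin 4), (0 : Fin 6)) := by
  unfold IsTriangle cxHIJ cxHJK cxHKI
  decide

/-- `|G| = 16`. -/
theorem card_G16 : Fintype.card G16 = 16 := by
  simp [G16, Fintype.card_prod, ZMod.card]

/-- (U5) IS FALSE.  There is a normal-form configuration without accidental solutions in a group of order `16`
and a triangle `(i₀, j₀, k₀)` of it such that the product of the numbers of triangles through `i₀`, through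
`j₀` and through `k₀` exceeds `|G|²`: here `12 · 6 · 4 = 288 > 256`. -/
theorem localDegreeProduct_counterexample :
    ∃ (x : Fin 1 → G16) (y : Fin 4 → G16) (z : Fin 6 → G16) (HIJ : Finset (Fin 1 × Fin 4))
      (HJK : Finset (Fin 4 × Fin 6)) (HKI : Finset (Fin 6 × Fin 1)) (i₀ : Fin 1) (j₀ : Fin 4) (k₀ : Fin 6),
      NoAccidental x y z HIJ HJK HKI ∧ IsTriangle HIJ HJK HKI (i₀, j₀, k₀) ∧
      Fintype.card G16 ^ 2 <
        ((triangleSet HIJ HJK HKI).filter (fun τ => τ.1 = i₀)).card *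
        ((triangleSet HIJ HJK HKI).filter (fun τ => τ.2.1 = j₀)).card *
        ((triangleSet HIJ HJK HKI).filter (fun τ => τ.2.2 = k₀)).card := by
  refine ⟨cxX, cxY, cxZ, cxHIJ, cxHJK, cxHKI, 0, 0, 0, cx_noAccidental, cx_triangle_000, ?_⟩
  have hI : ((triangleSet cxHIJ cxHJK cxHKI).filter (fun τ => τ.1 = (0 : Fin 1))).card = 12 := by
    rw [Finset.filter_true_of_mem (fun τ _ => Subsingleton.elim _ _), cx_card_triangles]
  rw [hI, cx_card_link_j0, cx_card_link_k0, card_G16]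
  norm_num

end Counterexample

end Summit.MatrixMultiplication.MatrixMultiplication.Theorems.SoloVal
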